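import Mathlib.LinearAlgebra.Alternating.Basic
import Mathlib.LinearAlgebra.PiTensorProduct.Basic
import Mathlib.LinearAlgebra.ExteriorPower.Basic
import Mathlib.LinearAlgebra.Dimension.FreeAndStrongRankCondition
import Mathlib.LinearAlgebra.Dimension.Finrank
import Mathlib.LinearAlgebra.Basis.VectorSpace
import Mathlib.LinearAlgebra.Matrix.Determinant.Basic
import HarnessLib

/-!
# Barrier (BirchSwinnertonDyer): localised rank-`r` determinant ("plectic") receptacles vanish on `∧ʳ A(ℚ)`

Barrier catalogue `Literature/Barriers/BirchSwinnertonDyer/` (D-0021), entry for the technique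
class **rank-`r` determinant / plectic receptacles**: certifying a non-zero element
`P₁ ∧ … ∧ P_r` of the `r`-th exterior power of a group of global points by LOCALISING at `r`
`p`-adic places and taking a determinant.

## What the sources print

M. Fornea, L. Gehrmann, *Plectic Stark–Heegner points*, Adv. Math. 414 (2023) = arXiv:2104.12575
(`ForneaGehrmann2023`), §1.1: for a modular elliptic curve `A/F`, a quadratic extension `E/F`, a
rational prime `p` and a set `S = {𝔭₁, …, 𝔭_r}` of `r` distinct `p`-adic primes of `F` inert in
`E`, with embeddings `ι_𝔭 : E ↪ E_𝔭`, the composite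
`det = loc_S ∘ ∧ʳ𝒦 : ∧ʳ A(E) → ⊗ʳ_{ℚ_p} H¹_f(E, V_p(A)) → ⊗_{𝔭 ∈ S} (Â(E_𝔭) ⊗_{ℤ_p} ℚ_p)` is
"given by `det(P₁ ∧ ⋯ ∧ P_r) = det (ι_{𝔭_j}(P_i))_{i,j}`" (display before Rem. 1.1; the same
recipe `det : ∧ʳ A(E_𝔠) → Â(E_S)` in §1.4), and it is the receptacle of the plectic `p`-adic
invariants and plectic Stark–Heegner points (Conj. 1.3: "`P^χ_A = det(w^χ_A)`" for some
`w^χ_A ∈ ∧ʳ A(E_𝔠)^χ` when `r_alg(A/E, χ) ≥ r`; Conj. 1.5: `P^χ_A ≠ 0 ⟹ r_alg(A/E, χ) = r`).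
**Remark 1.1** (verbatim): "Unfortunately, the localization process loses information when
global classes are annihilated. For instance, if the elliptic curve `A/F` can be defined over `ℚ`
and `r ≥ 2`, the map `det = loc_S ∘ (∧ʳ𝒦) : ∧ʳ A(ℚ) → ∧ʳ(Â(ℚ_p) ⊗_{ℤ_p} ℚ_p) ↪
⊗_{𝔭 ∈ S} (Â(ℚ_p) ⊗_{ℤ_p} ℚ_p)` equals zero because `Â(ℚ_p)` has `ℤ_p`-rank one."
H. Darmon, M. Fornea, *Mock plectic points*, J. Inst. Math. Jussieu 24 (2025) (`DarmonFornea2025`),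
§3.8 Remark 5: "The fact that the plectic invariant is forced to lie in a specific eigenspace for
complex conjugation and can sometimes vanish for trivial reasons (for example, when `E(ℚ)` has
rank two) suggests that it is only 'part of the story' …".

## What this file proves (pure linear algebra; everything below is a theorem)

* `locDeterminant ι` — the technique class made explicit: for a commutative ring `R`, a module
  `V` of "global points", receptacles `L j` (`j : Fin r`) and localisation maps
  `ι j : V →ₗ[R] L j`, the alternating `r`-linear map `V^r → ⨂_j L j`,
  `(P_i) ↦ Σ_σ sgn σ · ⊗_j ι_j(P_{σ j})` — the Leibniz expansion of FG's `det (ι_{𝔭_j}(P_i))_{i,j}`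
  (`locDeterminant_apply`); `locDeterminantPower ι : ⋀[R]^r V →ₗ[R] ⨂_j L j` is its descent to
  the exterior power (`locDeterminantPower_ιMulti`), i.e. FG's `det` on `∧ʳ`.
* `alternatingMap_eq_zero_of_forall_exists_smul`, `alternatingMap_eq_zero_of_rank_le_one` — the
  mechanism: an alternating `r`-linear map out of a cyclic module / a vector space of rank `≤ 1`
  is identically zero once `r ≥ 2`.
* THE WALL. `locDeterminant_eq_zero_of_rank_le_one`, `plecticDeterminant_restrict_eq_zero`,
  `locDeterminantPower_comp_eq_zero`, `sum_sign_smul_tprod_eq_zero`: if all localisation maps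
  restricted to the points under consideration factor through ONE space `L₀` of rank `≤ 1`
  (`ι j = e j ∘ κ`, `κ : V → L₀`; for `A` defined over `ℚ` and points of `A(ℚ)`: every
  `ι_{𝔭_j}|_{A(ℚ)}` is the one map `A(ℚ) → Â(ℚ_p) ⊗ ℚ_p` followed by `Â(ℚ_p) ⊗ ℚ_p → Â(E_{𝔭_j}) ⊗ ℚ_p`)
  and `r ≥ 2`, the determinant vanishes identically — as an alternating map, on the exterior
  power, and tuple-by-tuple for an ARBITRARY map of sets `κ` (so also for the bare abelian group
  `A(ℚ)`); `exteriorPower_subsingleton_of_rank_le_one`, `exteriorPower_map_eq_zero_of_rank_le_one`: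
  FG's middle term `∧ʳ(Â(ℚ_p) ⊗ ℚ_p)` is the zero space and `∧ʳκ = 0`.
* `PlecticDeterminantVanishesOverQ` (the barrier `Prop`, receptacle of rank EXACTLY one as
  printed), PROVED as `plecticDeterminantVanishesOverQ_holds`.
* Sharpness of the two hypotheses ([folklore] linear algebra, recorded for the `scope_caveats:` /
  `evasions_known:` lines): `locDeterminant_proj_single`, `locDeterminant_proj_single_ne_zero` —
  rank-one receptacles with DIFFERENT functionals per column are not obstructed (the determinant
  of the coordinate functionals on the standard basis is `⊗_j 1 ≠ 0`);
  `lift_det_locDeterminant_id`, `locDeterminant_id_ne_zero` — one and the same map into a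
  receptacle of rank `r` is not obstructed either (the value on a basis pairs to `r!` against the
  determinant, non-zero in characteristic `0`).

## Modelling

`Â(ℚ_p) ⊗_{ℤ_p} ℚ_p` is modelled as an arbitrary vector space `L₀` with `Module.rank K L₀ ≤ 1`
(theorems) / `Module.finrank K L₀ = 1` (the barrier `Prop`, "`ℤ_p`-rank one") over an arbitrary
field `K` (= `ℚ_p`); the receptacle `⊗_{𝔭 ∈ S}(…)` is Mathlib's `PiTensorProduct` over `K`, as
FG's `⊗ʳ_{ℚ_p}`; the arithmetic inputs (that the restrictions `ι_𝔭|_{A(ℚ)}` all factor through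
`Â(ℚ_p) ⊗ ℚ_p`, and that this is a line) enter as the hypotheses "`ι j = e j ∘ κ`" and
"rank `≤ 1`" and are not derived here.

## References

* M. Fornea, L. Gehrmann, *Plectic Stark–Heegner points*, Adv. Math. 414 (2023) 108861,
  arXiv:2104.12575, §1.1 (display before Rem. 1.1), Rem. 1.1, §1.4, Conj. 1.3, Conj. 1.5
  [ForneaGehrmann2023].
* H. Darmon, M. Fornea, *Mock plectic points*, J. Inst. Math. Jussieu 24 (2025) 2107–2131,
  arXiv:2310.16758, Abstract, §3.8 (Conj. 3.9, Conj. 3.10, Remark 5) [DarmonFornea2025].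
* M. Fornea, X. Guitart, M. Masdeu, *Plectic `p`-adic invariants*, Adv. Math. 406 (2022),
  Abstract [ForneaGuitartMasdeu2022].
-/

noncomputable section

open scoped TensorProduct
open PiTensorProduct

namespace Literature.Barriers.BirchSwinnertonDyer

universe u v w w'

/-! ### The mechanism: alternating maps out of a line vanish in `≥ 2` variables -/

/-- **An alternating `r`-linear map out of a cyclic module is zero for `r ≥ 2`.** If every
element of `M` is a multiple of one vector `v₀`, then for `x : Fin r → M` write `x j = c j • v₀`;
multilinearity gives `f x = (∏ c j) • f (v₀, …, v₀)` and the last value vanishes because two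
arguments coincide. (This is "equals zero because `Â(ℚ_p)` has `ℤ_p`-rank one" of
[cite: ForneaGehrmann2023, Rem. 1.1], at the level of bare linear algebra.) [folklore] -/
theorem alternatingMap_eq_zero_of_forall_exists_smul {R M N : Type*} [CommSemiring R]
    [AddCommMonoid M] [Module R M] [AddCommMonoid N] [Module R N] {r : ℕ} (hr : 2 ≤ r)
    {v₀ : M} (hM : ∀ v : M, ∃ c : R, c • v₀ = v) (f : M [⋀^Fin r]→ₗ[R] N) : f = 0 := by
  ext x
  choose c hc using fun j => hM (x j)
  have hx : x = fun j => c j • v₀ := funext fun j => (hc j).symm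
  have h01 : (⟨0, by omega⟩ : Fin r) ≠ ⟨1, by omega⟩ := by simp [Fin.ext_iff]
  rw [hx, AlternatingMap.map_smul_univ, AlternatingMap.zero_apply,
    f.map_eq_zero_of_eq (fun _ => v₀) rfl h01, smul_zero]

/-- **An alternating `r`-linear map out of a vector space of rank `≤ 1` is zero for `r ≥ 2`.**
[folklore] -/
theorem alternatingMap_eq_zero_of_rank_le_one {K L₀ N : Type*} [Field K] [AddCommGroup L₀]
    [Module K L₀] [AddCommGroup N] [Module K N] {r : ℕ} (hr : 2 ≤ r)
    (hL : Module.rank K L₀ ≤ 1) (f : L₀ [⋀^Fin r]→ₗ[K] N) : f = 0 := by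
  obtain ⟨v₀, hv₀⟩ := rank_le_one_iff.mp hL
  exact alternatingMap_eq_zero_of_forall_exists_smul hr hv₀ f

/-! ### The technique class: localised determinant receptacles -/

section Receptacle

variable {R : Type*} [CommRing R] {r : ℕ} {V : Type*} [AddCommGroup V] [Module R V]
  {L : Fin r → Type*} [∀ j, AddCommGroup (L j)] [∀ j, Module R (L j)]

/-- **Localised determinant receptacle map** (Fornea–Gehrmann's `det`, at the level of
`r`-tuples). Given localisation maps `ι j : V →ₗ[R] L j` of a module `V` of global points into
receptacles `L j` (`j : Fin r`; in FG: `V = A(E)`, `L j = Â(E_{𝔭_j}) ⊗_{ℤ_p} ℚ_p`,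
`ι j = ι_{𝔭_j}`), the alternating `r`-linear map `(P_i)_i ↦ det (ι_j(P_i))_{i,j} :=
Σ_σ sgn σ · ⊗_j ι_j (P_{σ j}) ∈ ⨂_j L j` (Leibniz expansion, column `j` living in the `j`-th
receptacle). [cite: ForneaGehrmann2023, §1.1 (display before Rem. 1.1) and §1.4] -/
def locDeterminant (ι : ∀ j : Fin r, V →ₗ[R] L j) : V [⋀^Fin r]→ₗ[R] (⨂[R] j, L j) :=
  MultilinearMap.alternatization
    ((PiTensorProduct.tprod R : MultilinearMap R L (⨂[R] j, L j)).compLinearMap ι)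

/-- The Leibniz formula `det (ι_j(P_i))_{i,j} = Σ_σ sgn σ · ⊗_j ι_j(P_{σ j})`.
[cite: ForneaGehrmann2023, §1.1 (display before Rem. 1.1)] -/
theorem locDeterminant_apply (ι : ∀ j : Fin r, V →ₗ[R] L j) (P : Fin r → V) :
    locDeterminant ι P =
      ∑ σ : Equiv.Perm (Fin r), Equiv.Perm.sign σ • (⨂ₜ[R] j, ι j (P (σ j))) := by
  simp only [locDeterminant, MultilinearMap.alternatization_apply,
    MultilinearMap.domDomCongr_apply, MultilinearMap.compLinearMap_apply]

/-- Restricting the points along `κ : V' → V` composes every localisation map with `κ`.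
[folklore] -/
theorem locDeterminant_comp {V' : Type*} [AddCommGroup V'] [Module R V']
    (ι : ∀ j : Fin r, V →ₗ[R] L j) (κ : V' →ₗ[R] V) :
    locDeterminant (fun j => (ι j).comp κ) = (locDeterminant ι).compLinearMap κ := by
  ext P
  simp only [locDeterminant_apply, LinearMap.coe_comp, Function.comp_apply,
    AlternatingMap.compLinearMap_apply]

/-- **FG's `det` on the exterior power**: the descent of `locDeterminant ι` to
`⋀[R]^r V →ₗ[R] ⨂_j L j` (`det : ∧ʳ A(E) → ⊗_{𝔭 ∈ S}(Â(E_𝔭) ⊗ ℚ_p)`).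
[cite: ForneaGehrmann2023, §1.1 (display before Rem. 1.1)] -/
def locDeterminantPower (ι : ∀ j : Fin r, V →ₗ[R] L j) : ⋀[R]^r V →ₗ[R] (⨂[R] j, L j) :=
  exteriorPower.alternatingMapLinearEquiv (locDeterminant ι)

/-- `det (P₁ ∧ ⋯ ∧ P_r) = det (ι_j(P_i))_{i,j}`. [cite: ForneaGehrmann2023, §1.1] -/
theorem locDeterminantPower_ιMulti (ι : ∀ j : Fin r, V →ₗ[R] L j) (P : Fin r → V) :
    locDeterminantPower ι (exteriorPower.ιMulti R r P) = locDeterminant ι P :=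
  exteriorPower.alternatingMapLinearEquiv_apply_ιMulti _ _

end Receptacle

/-! ### The wall: a common factorisation through a line kills the determinant -/

section Wall

variable {K : Type*} [Field K] {r : ℕ} {V L₀ : Type*} [AddCommGroup V] [Module K V]
  [AddCommGroup L₀] [Module K L₀] {L : Fin r → Type*} [∀ j, AddCommGroup (L j)]
  [∀ j, Module K (L j)]

/-- **The determinant receptacle of a line is zero** (`r ≥ 2`): for ANY receptacle maps
`e j : L₀ →ₗ[K] L j` out of a space `L₀` of rank `≤ 1`, `locDeterminant e = 0`.
[cite: ForneaGehrmann2023, Rem. 1.1] -/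
theorem locDeterminant_eq_zero_of_rank_le_one (hr : 2 ≤ r) (hL : Module.rank K L₀ ≤ 1)
    (e : ∀ j : Fin r, L₀ →ₗ[K] L j) : locDeterminant e = 0 :=
  alternatingMap_eq_zero_of_rank_le_one hr hL _

/-- **The wall (Fornea–Gehrmann, Rem. 1.1), alternating-map form.** If the `r ≥ 2` localisation
maps restricted to `V` all factor through one space `L₀` of rank `≤ 1` — `ι j = e j ∘ κ` with a
single `κ : V →ₗ[K] L₀` (for `A` defined over `ℚ` and `V = A(ℚ) ⊗ ℚ_p`: `κ` the map to
`Â(ℚ_p) ⊗_{ℤ_p} ℚ_p`, `e j` the inclusion into `Â(E_{𝔭_j}) ⊗ ℚ_p`) — then the localised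
determinant is identically zero: every column of `(ι_j(P_i))_{i,j}` is the same vector of
elements of a line. [cite: ForneaGehrmann2023, Rem. 1.1] -/
theorem plecticDeterminant_restrict_eq_zero (hr : 2 ≤ r) (hL : Module.rank K L₀ ≤ 1)
    (e : ∀ j : Fin r, L₀ →ₗ[K] L j) (κ : V →ₗ[K] L₀) :
    locDeterminant (fun j => (e j).comp κ) = 0 := by
  rw [locDeterminant_comp, locDeterminant_eq_zero_of_rank_le_one hr hL e]
  ext P
  simp only [AlternatingMap.compLinearMap_apply, AlternatingMap.zero_apply]

/-- **The wall on the exterior power**: FG's `det = loc_S ∘ ∧ʳ𝒦` is the zero map on `⋀ʳ V`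
when all localisations factor through a line and `r ≥ 2`. [cite: ForneaGehrmann2023, Rem. 1.1] -/
theorem locDeterminantPower_comp_eq_zero (hr : 2 ≤ r) (hL : Module.rank K L₀ ≤ 1)
    (e : ∀ j : Fin r, L₀ →ₗ[K] L j) (κ : V →ₗ[K] L₀) :
    locDeterminantPower (fun j => (e j).comp κ) = 0 := by
  rw [locDeterminantPower, plecticDeterminant_restrict_eq_zero hr hL e κ, map_zero]

/-- **The wall, tuple by tuple, for an arbitrary map of sets `κ`** (so in particular for the bare
abelian group `A(ℚ)` and the group homomorphism `A(ℚ) → Â(ℚ_p) ⊗ ℚ_p`, with no `K`-structure on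
the points): `det (e_j(κ(P_i)))_{i,j} = Σ_σ sgn σ · ⊗_j e_j(κ(P_{σ j})) = 0` for all
`P₁, …, P_r`, `r ≥ 2`, whenever the common target `L₀` has rank `≤ 1`.
[cite: ForneaGehrmann2023, Rem. 1.1] -/
theorem sum_sign_smul_tprod_eq_zero (hr : 2 ≤ r) (hL : Module.rank K L₀ ≤ 1)
    (e : ∀ j : Fin r, L₀ →ₗ[K] L j) {A : Type*} (κ : A → L₀) (P : Fin r → A) :
    ∑ σ : Equiv.Perm (Fin r), Equiv.Perm.sign σ • (⨂ₜ[K] j, e j (κ (P (σ j)))) = 0 := by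
  have h := DFunLike.congr_fun (locDeterminant_eq_zero_of_rank_le_one hr hL e) (κ ∘ P)
  simpa only [locDeterminant_apply, Function.comp_apply, AlternatingMap.zero_apply] using h

/-- **FG's middle term `∧ʳ(Â(ℚ_p) ⊗_{ℤ_p} ℚ_p)` is the zero space**: the `r`-th exterior power of
a space of rank `≤ 1` is trivial for `r ≥ 2` (its generators `ιMulti` are values of an
alternating map out of a line). [cite: ForneaGehrmann2023, Rem. 1.1] -/
theorem exteriorPower_subsingleton_of_rank_le_one (hr : 2 ≤ r) (hL : Module.rank K L₀ ≤ 1) :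
    Subsingleton (⋀[K]^r L₀) := by
  have h0 : exteriorPower.ιMulti K r (M := L₀) = 0 :=
    alternatingMap_eq_zero_of_rank_le_one hr hL _
  have htop : (⊤ : Submodule K (⋀[K]^r L₀)) = ⊥ := by
    rw [← exteriorPower.ιMulti_span]
    refine (Submodule.span_eq_bot (R := K)).mpr ?_
    rintro _ ⟨x, rfl⟩
    simp [h0]
  refine ⟨fun x y => ?_⟩
  have hx : x ∈ (⊤ : Submodule K (⋀[K]^r L₀)) := Submodule.mem_top
  have hy : y ∈ (⊤ : Submodule K (⋀[K]^r L₀)) := Submodule.mem_top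
  rw [htop, Submodule.mem_bot] at hx hy
  rw [hx, hy]

/-- … hence **`∧ʳκ : ⋀ʳ V → ⋀ʳ L₀` is the zero map** (the first arrow of FG's display in
Rem. 1.1). [cite: ForneaGehrmann2023, Rem. 1.1] -/
theorem exteriorPower_map_eq_zero_of_rank_le_one (hr : 2 ≤ r) (hL : Module.rank K L₀ ≤ 1)
    (κ : V →ₗ[K] L₀) : exteriorPower.map r κ = 0 := by
  haveI := exteriorPower_subsingleton_of_rank_le_one (K := K) (L₀ := L₀) hr hL
  exact LinearMap.ext fun _ => Subsingleton.elim _ _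

end Wall

/-! ### Sharpness of the two hypotheses ([folklore] linear algebra) -/

section Sharpness

variable {K : Type*} [Field K]

/-- **Different functionals into rank-one receptacles are NOT obstructed.** With `V = K^r`,
receptacles `L j = K` (rank one!) and the `r` DIFFERENT coordinate functionals as localisation
maps, the determinant of the standard basis is `⊗_j 1` (only `σ = 1` survives in the Leibniz
sum). This is the abstract shape of FG's genuine setting — points over the CM extension read
through `r` distinct embeddings `ι_{𝔭_j}` [cite: ForneaGehrmann2023, §1.4] — as opposed to the
`ℚ`-rational case of Rem. 1.1. [folklore] -/
theorem locDeterminant_proj_single (r : ℕ) :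
    locDeterminant (R := K) (fun j : Fin r => (LinearMap.proj j : (Fin r → K) →ₗ[K] K))
        (fun i : Fin r => (Pi.single i 1 : Fin r → K)) = ⨂ₜ[K] _ : Fin r, (1 : K) := by
  rw [locDeterminant_apply,
    Finset.sum_eq_single_of_mem (1 : Equiv.Perm (Fin r)) (Finset.mem_univ _)]
  · simp only [Equiv.Perm.sign_one, one_smul, Equiv.Perm.coe_one, id_eq, LinearMap.coe_proj,
      Function.eval, Pi.single_eq_same]
  · intro σ _ hσ
    obtain ⟨j, hj⟩ : ∃ j, ¬σ j = (1 : Equiv.Perm (Fin r)) j := not_forall.mp (mt Equiv.ext hσ)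
    rw [Equiv.Perm.one_apply] at hj
    have hz : (fun j' : Fin r =>
        (LinearMap.proj j' : (Fin r → K) →ₗ[K] K) (Pi.single (σ j') (1 : K))) j = 0 := by
      simp only [LinearMap.coe_proj, Function.eval, Pi.single_apply, if_neg (Ne.symm hj)]
    rw [MultilinearMap.map_coord_zero (PiTensorProduct.tprod K) j hz]
    exact smul_zero (Equiv.Perm.sign σ)

/-- `⊗_j 1 ≠ 0` in `⨂_{j : Fin r} K` (pair it with the multiplication functional). [folklore] -/
theorem tprod_one_ne_zero (r : ℕ) : (⨂ₜ[K] _ : Fin r, (1 : K)) ≠ 0 := by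
  intro h
  have h' := congrArg (PiTensorProduct.lift (MultilinearMap.mkPiAlgebra K (Fin r) K)) h
  rw [PiTensorProduct.lift.tprod, MultilinearMap.mkPiAlgebra_apply, map_zero] at h'
  simp only [Finset.prod_const_one, one_ne_zero] at h'

/-- **Corollary**: the rank-one-receptacle determinant with distinct functionals is non-zero on
the standard basis, for every `r` (in particular `r ≥ 2`). [folklore] -/
theorem locDeterminant_proj_single_ne_zero (r : ℕ) :
    locDeterminant (R := K) (fun j : Fin r => (LinearMap.proj j : (Fin r → K) →ₗ[K] K))
        (fun i : Fin r => (Pi.single i 1 : Fin r → K)) ≠ 0 := by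
  rw [locDeterminant_proj_single]
  exact tprod_one_ne_zero r

/-- **One and the same map into a receptacle of rank `r` is NOT obstructed either**: with
`κ = e j = id` on `V = L₀ = K^r` (rank `r`, not `1`), the determinant of the standard basis
`(rows of the identity matrix)` pairs to `r!` against the determinant functional
`⨂_j K^r → K`: `Σ_σ sgn σ · det(rows e_{σ j}) = Σ_σ (sgn σ)² = r!`. [folklore] -/
theorem lift_det_locDeterminant_id (r : ℕ) :
    PiTensorProduct.lift
        ((Matrix.detRowAlternating : (Fin r → K) [⋀^Fin r]→ₗ[K] K) :
          MultilinearMap K (fun _ : Fin r => Fin r → K) K)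
        (locDeterminant (fun _ : Fin r => (LinearMap.id : (Fin r → K) →ₗ[K] (Fin r → K)))
          (fun i : Fin r => (1 : Matrix (Fin r) (Fin r) K) i)) = (r.factorial : K) := by
  have hdet : (Matrix.detRowAlternating : (Fin r → K) [⋀^Fin r]→ₗ[K] K)
      (fun i : Fin r => (1 : Matrix (Fin r) (Fin r) K) i) = 1 :=
    Matrix.det_one
  rw [locDeterminant_apply, map_sum]
  have hterm : ∀ σ : Equiv.Perm (Fin r),
      PiTensorProduct.lift
          ((Matrix.detRowAlternating : (Fin r → K) [⋀^Fin r]→ₗ[K] K) :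
            MultilinearMap K (fun _ : Fin r => Fin r → K) K)
          (Equiv.Perm.sign σ • (⨂ₜ[K] j, (LinearMap.id : (Fin r → K) →ₗ[K] (Fin r → K))
            ((1 : Matrix (Fin r) (Fin r) K) (σ j)))) = 1 := by
    intro σ
    rw [Units.smul_def, map_zsmul, PiTensorProduct.lift.tprod]
    simp only [LinearMap.id_coe, id_eq, AlternatingMap.coe_multilinearMap]
    have hperm := (Matrix.detRowAlternating : (Fin r → K) [⋀^Fin r]→ₗ[K] K).map_perm
      (fun i : Fin r => (1 : Matrix (Fin r) (Fin r) K) i) σ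
    simp only [Function.comp_def] at hperm
    rw [hperm, hdet, Units.smul_def, smul_smul, ← Units.val_mul, Int.units_mul_self,
      Units.val_one, one_smul]
  simp only [hterm, Finset.sum_const, Finset.card_univ, Fintype.card_perm, Fintype.card_fin,
    nsmul_eq_mul, mul_one]

/-- **Corollary** (characteristic `0`): with a rank-`r` receptacle at a single place and equal
maps, the determinant of `r` independent points is non-zero — the linear-algebra content of the
"receptacle of dimension `≥ r`" way around Rem. 1.1. [folklore] -/
theorem locDeterminant_id_ne_zero [CharZero K] (r : ℕ) :
    locDeterminant (fun _ : Fin r => (LinearMap.id : (Fin r → K) →ₗ[K] (Fin r → K)))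
        (fun i : Fin r => (1 : Matrix (Fin r) (Fin r) K) i) ≠ 0 := by
  intro h
  have h' := lift_det_locDeterminant_id (K := K) r
  rw [h, map_zero] at h'
  exact (Nat.cast_ne_zero.mpr (Nat.factorial_ne_zero r)) h'.symm

end Sharpness

/-! ### The barrier -/

/-- **Barrier (named statement, PROVED below): localised rank-`r` determinant receptacles vanish
identically on points whose localisations factor through a line** — Fornea–Gehrmann, Rem. 1.1:
"if the elliptic curve `A/F` can be defined over `ℚ` and `r ≥ 2`, the map
`det = loc_S ∘ (∧ʳ𝒦) : ∧ʳ A(ℚ) → ∧ʳ(Â(ℚ_p) ⊗_{ℤ_p} ℚ_p) ↪ ⊗_{𝔭 ∈ S}(Â(ℚ_p) ⊗_{ℤ_p} ℚ_p)`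
equals zero because `Â(ℚ_p)` has `ℤ_p`-rank one." Formally: for every field `K`, every
`r ≥ 2`, every `K`-space `L₀` of dimension exactly `1` ("rank one"), all receptacles `L j` and
`K`-linear maps `e j : L₀ → L j`, every set `A` with a map `κ : A → L₀` and all
`P₁, …, P_r ∈ A`: `Σ_σ sgn σ · ⊗_j e_j(κ(P_{σ j})) = 0` in `⨂_j L j`.

BARRIER (D-0021), one line per key:
* technique_class: rank-`r` localised determinant ("plectic") receptacles — formally `locDeterminant ι` / `locDeterminantPower ι` for localisation maps `ι j : V →ₗ L j`, `j : Fin r`: certify `P₁ ∧ ⋯ ∧ P_r ≠ 0` (hence rank `≥ r`) by the non-vanishing of `det(ι_{𝔭_j}(P_i))_{i,j} = Σ_σ sgn σ · ⊗_j ι_j(P_{σ j}) ∈ ⊗_j L j` obtained by localising at `r` `p`-adic places [cite: ForneaGehrmann2023, §1.1 (display before Rem. 1.1: `det = loc_S ∘ ∧ʳ𝒦 : ∧ʳA(E) → ⊗_{𝔭∈S}(Â(E_𝔭) ⊗_{ℤ_p} ℚ_p)`) and §1.4 (`det : ∧ʳ A(E_𝔠) → Â(E_S)`)] — the receptacle in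 which plectic `p`-adic invariants and plectic Stark–Heegner points are read [cite: ForneaGehrmann2023, Conj. 1.3 (`P^χ_A = det(w^χ_A)`, `w^χ_A ∈ ∧ʳ A(E_𝔠)^χ`) and Conj. 1.5 (`P^χ_A ≠ 0 ⟹ r_alg(A/E,χ) = r`)], a `p`-adic stand-in for the plectic image of `P ∈ ∧ʳA(E)` under `∧ʳ𝒦` predicted by Nekovář–Scholl [cite: ForneaGehrmann2023, §1.1].
* blocks: certifying `rank A(ℚ) ≥ 2` for an elliptic curve DEFINED OVER `ℚ` from such a receptacle when the points are `ℚ`-rational, so that all `ι_{𝔭_j}|_{A(ℚ)}` are the single map `A(ℚ) → Â(ℚ_p) ⊗_{ℤ_p} ℚ_p` into a line: for `r ≥ 2` the determinant is then identically `0` (theorems `plecticDeterminant_restrict_eq_zero`, `locDeterminantPower_comp_eq_zero`, `sum_sign_smul_tprod_eq_zero`; `∧ʳ(Â(ℚ_p) ⊗ ℚ_p) = 0`, `exteriorPower_subsingleton_of_rank_le_one`) [cite: ForneaGehrmann2023, Rem. 1.1], so no statement "`det(P₁ ∧ P₂) ≠ 0`" read there can witness two independent rational points — "can sometimes vanish for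 trivial reasons (for example, when `E(ℚ)` has rank two)" [cite: DarmonFornea2025, §3.8 Remark 5]; in the tree this bears on lower-bound (`r_MW ≥ 2` / `r_MW ≥ 1 from r_an ≥ 2`) readings of plectic points for `E/ℚ` at `ℚ_p` proposed around the route items `HigherGZConstructionR2` (stmt-BirchSwinnertonDyer-0501) and `SqueezeOnePoint` (stmt-BirchSwinnertonDyer-0143, route `Squeeze`).
* because: every column of `(ι_{𝔭_j}(P_i))_{i,j}` is the same vector `(κ(P_i))_i` with entries in a line `L₀ = K · v₀`; writing `κ(P_i) = c_i v₀`, multilinearity gives `⊗_j e_j(κ(P_{σ j})) = (∏_i c_i) · ⊗_j e_j(v₀)` independently of `σ`, and an alternating map vanishes on the constant family (two equal arguments), so the Leibniz sum is `0` (theorems `alternatingMap_eq_zero_of_forall_exists_smul`, `alternatingMap_eq_zero_of_rank_le_one`, `locDeterminant_eq_zero_of_rank_le_one`) — "equals zero because `Â(ℚ_p)` has `ℤ_p`-rank one" [cite: ForneaGehrmann2023, Rem. 1.1]; "the localization process loses information when global classes are annihilated" [cite: ForneaGehrmann2023, Rem. 1.1].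
* evasions_known: none of (i)–(iii) is a theorem — they rest on FG Conj. 1.3 / 1.5 and DF Conj. 3.9 / 3.10 — (i) leave `A(ℚ)`: read points over ring class fields of the CM extension `E/F` through `r` DISTINCT embeddings `ι_𝔭 : E_𝔠 ↪ E_𝔭`, `𝔭 ∈ S` inert in `E` (FG's actual setting; Conj. 1.3 predicts `P^χ_A = det(w^χ_A)` with `w^χ_A ∈ ∧ʳA(E_𝔠)^χ`) [cite: ForneaGehrmann2023, §1.4, Conj. 1.3, Conj. 1.5] — distinct functionals per column are not obstructed even into rank-one receptacles (theorem `locDeterminant_proj_single_ne_zero`, [folklore]); (ii) a receptacle of rank `≥ r` at one place with one map is not obstructed (theorem `locDeterminant_id_ne_zero`: the value on a basis pairs to `r! ≠ 0`, [folklore]); (iii) for curves of rank two over `ℚ`: mock plectic invariants, "expected to lie in the alternating square of the Mordell–Weil group of certain elliptic curves of rank two over `ℚ`" [cite: DarmonFornea2025, Abstract], predicted (Conj. 3.10) to lie in the image of the regulator `∧²E(K) → H¹_f(K, T_p(E)) ⊗_{ℤ_p} K_p`, `P ∧ Q ↦ δ_∞(P) ⊗ log_E^{a_p}(Q) − δ_∞(Q)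 ⊗ log_E^{a_p}(P)`, which pairs TWO DIFFERENT maps (Kummer class and `p`-adic logarithm) instead of one [cite: DarmonFornea2025, §3.8 Conj. 3.9 and Conj. 3.10], and the proposed upgrade "from tensor products of `p`-adic points to global cohomology classes" which "would take care of the degeneracies of the original construction" [cite: DarmonFornea2025, §3.8 Remark 5]; numerical evidence for plectic invariants themselves [cite: ForneaGuitartMasdeu2022, Abstract].
* scope_caveats: (a) a statement about LOCALISED determinants all of whose columns factor through ONE space of rank `≤ 1`; it does not obstruct global elements of `∧ʳA(ℚ)` themselves, receptacles of rank `≥ r` (theorem `locDeterminant_id_ne_zero`), distinct functionals per column (theorem `locDeterminant_proj_single_ne_zero`), nor `r = 1` (the hypothesis `2 ≤ r` is essential: for `r = 1` the map is `e 0 ∘ κ` itself); (b) the source prints the remark for `Â(ℚ_p)` of `ℤ_p`-rank one and the receptacle `⊗_{ℚ_p}` [cite: ForneaGehrmann2023, Rem. 1.1]; here `Â(ℚ_p) ⊗_{ℤ_p} ℚ_p` is an arbitrary vector space of dimension `1` (theorems: rank `≤ 1`) over an arbitrary field and the tensor product is Mathlib's `PiTensorProduct` over that field — that the restrictions `ι_𝔭|_{A(ℚ)}`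 factor through this line is the hypothesis "`ι j = e j ∘ κ`", an arithmetic input not derived in this file; (c) tensor products over `ℤ` (rather than `ℚ_p`) are not covered and not asserted by the source; (d) nothing here bears on FG Conj. 1.3 / 1.5 or the Nekovář–Scholl programme themselves, which "seem to be out of reach at present" [cite: ForneaGehrmann2023, §1.1].
* status: established (remark-level theorem of linear algebra [cite: ForneaGehrmann2023, Rem. 1.1]; proved here: `plecticDeterminantVanishesOverQ_holds`)

[cite: ForneaGehrmann2023, Rem. 1.1] [cite: DarmonFornea2025, §3.8 Remark 5] -/
def PlecticDeterminantVanishesOverQ : Prop :=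
  ∀ (K : Type u) [Field K] (r : ℕ), 2 ≤ r →
    ∀ (L₀ : Type v) [AddCommGroup L₀] [Module K L₀], Module.finrank K L₀ = 1 →
      ∀ (L : Fin r → Type w) [∀ j, AddCommGroup (L j)] [∀ j, Module K (L j)]
        (e : ∀ j : Fin r, L₀ →ₗ[K] L j) (A : Type w') (κ : A → L₀) (P : Fin r → A),
        ∑ σ : Equiv.Perm (Fin r), Equiv.Perm.sign σ • (⨂ₜ[K] j, e j (κ (P (σ j)))) = 0

/-- **`PlecticDeterminantVanishesOverQ` holds** (`sum_sign_smul_tprod_eq_zero` with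
`rank = 1 ≤ 1`). [cite: ForneaGehrmann2023, Rem. 1.1] -/
theorem plecticDeterminantVanishesOverQ_holds : PlecticDeterminantVanishesOverQ.{u, v, w, w'} := by
  intro K _ r hr L₀ _ _ hL L _ _ e A κ P
  have hrank : Module.rank K L₀ ≤ 1 := (Module.rank_eq_one_iff_finrank_eq_one.mpr hL).le
  exact sum_sign_smul_tprod_eq_zero hr hrank e κ P

end Literature.Barriers.BirchSwinnertonDyer

end
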